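import Summits.CriticalPhenomena.PercolationContinuityZ3.Theorems.PercNearOneGluingNoHeavyLowerTailForestRayleighKFive
import Summits.CriticalPhenomena.PercolationContinuityZ3.Theorems.PercNearOneGluingNoHeavyLowerTailForestRayleighEmbedding
import Summits.CriticalPhenomena.PercolationContinuityZ3.Theorems.PercNearOneGluingNoHeavyLowerTailForestRayleighClass
import HarnessLib

/-!
# Weighted forest negative correlation — every graph on at most five vertices is forest-Rayleigh

`forestsW_rayleigh_of_card_le_five`: over any vertex type with `≤ 5` elements, every loop-free edge
system `T` has the weighted forest Rayleigh property: for all activities `w ≥ 0`, all disjoint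
`D, K ⊆ T` and distinct `e, f`, `Z(D;K∪{e,f})·Z(D;K) ≤ Z(D;K∪e)·Z(D;K∪f)`. Consequences
(`…ForestRayleighClass`): for the weighted random forest / arboreal gas on any graph with at most five
vertices, at every `β > 0`: `P(e, f ∈ F) ≤ P(e ∈ F)·P(f ∈ F)` (`forests_negCorr_of_card_le_five`,
the Grimmett–Winkler–Kahn–Pemantle conjecture for these graphs, weighted form) and connection events
are positively correlated (`forestsW_conn_posCorr_of_card_le_five`, Theorem A of the programme memo).
Proof: embed into `Fin 5` (`rayleigh_of_embedding`) and use `forestsW_rayleigh_K5_fin`.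
Theorems only; no definitions, no `sorry`.
-/

open Finset SimpleGraph
open scoped Classical

namespace Summit.CriticalPhenomena.PercolationContinuityZ3.Theorems.ForestRayleigh

variable {V : Type*} [Fintype V] [DecidableEq V]

/-- **Every loop-free edge system on at most five vertices has the weighted forest Rayleigh
property.** [`forestsW_rayleigh_K5_fin` + `rayleigh_of_embedding`] -/
theorem forestsW_rayleigh_of_card_le_five (hV : Fintype.card V ≤ 5) (T : Finset (Sym2 V))
    (hT : ∀ z ∈ T, ¬z.IsDiag) :
    ∀ (w : Sym2 V → ℝ), (∀ x, 0 ≤ w x) → ∀ (D K : Finset (Sym2 V)) (e f : Sym2 V),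
      D ∪ insert e (insert f K) ⊆ T → Disjoint D K → e ∉ D → e ∉ K → f ∉ D →
      f ∉ K → e ≠ f →
      (∑ G ∈ D.powerset.filter (fun G =>
        (fromEdgeSet ((G ∪ (insert e (insert f (K))) : Finset (Sym2 V)) : Set (Sym2 V))).IsAcyclic), ∏ x ∈ G, w x) *
        (∑ G ∈ D.powerset.filter (fun G =>
        (fromEdgeSet ((G ∪ (K) : Finset (Sym2 V)) : Set (Sym2 V))).IsAcyclic), ∏ x ∈ G, w x) ≤
      (∑ G ∈ D.powerset.filter (fun G =>
        (fromEdgeSet ((G ∪ (insert e (K)) : Finset (Sym2 V)) : Set (Sym2 V))).IsAcyclic), ∏ x ∈ G, w x) *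
        (∑ G ∈ D.powerset.filter (fun G =>
        (fromEdgeSet ((G ∪ (insert f (K)) : Finset (Sym2 V)) : Set (Sym2 V))).IsAcyclic), ∏ x ∈ G, w x) := by
  set ψ : V → Fin 5 := fun v => Fin.castLE hV (Fintype.equivFin V v) with hψ
  have hinj : Function.Injective ψ := by
    intro a b h
    have h' := Fin.castLE_injective hV h
    exact (Fintype.equivFin V).injective h'
  have hall : ∀ z : Sym2 (Fin 5), ¬z.IsDiag → z ∈ ({s(0, 1), s(0, 2), s(0, 3), s(0, 4), s(1, 2), s(1, 3), s(1, 4), s(2, 3), s(2, 4), s(3, 4)} : Finset (Sym2 (Fin 5))) := by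
    decide
  have himg : T.image (Sym2.map ψ) ⊆ ({s(0, 1), s(0, 2), s(0, 3), s(0, 4), s(1, 2), s(1, 3), s(1, 4), s(2, 3), s(2, 4), s(3, 4)} : Finset (Sym2 (Fin 5))) :=
    fun z hz => hall z (image_not_isDiag ψ hinj T hT z hz)
  exact rayleigh_of_embedding ψ hinj T hT (rayleigh_mono _ _ himg forestsW_rayleigh_K5_fin)

/-- **Negative correlation of uniform / weighted random forests on graphs with at most five vertices**
(counting form of Grimmett–Winkler / Kahn / Pemantle for these graphs): for a loop-free edge set `E`
on `≤ 5` vertices and distinct `e, f ∈ E`,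
`#{F forest : e, f ∈ F} · #{F forest} ≤ #{F forest : e ∈ F} · #{F forest : f ∈ F}`. -/
theorem forests_negCorr_of_card_le_five (hV : Fintype.card V ≤ 5) (E : Finset (Sym2 V))
    (hE : ∀ z ∈ E, ¬z.IsDiag) {e f : Sym2 V} (he : e ∈ E) (hf : f ∈ E) (hef : e ≠ f) :
    #(E.powerset.filter fun F : Finset (Sym2 V) =>
        (fromEdgeSet ((F : Finset (Sym2 V)) : Set (Sym2 V))).IsAcyclic ∧ e ∈ F ∧ f ∈ F) *
      #(E.powerset.filter fun F : Finset (Sym2 V) =>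
        (fromEdgeSet ((F : Finset (Sym2 V)) : Set (Sym2 V))).IsAcyclic) ≤
    #(E.powerset.filter fun F : Finset (Sym2 V) =>
        (fromEdgeSet ((F : Finset (Sym2 V)) : Set (Sym2 V))).IsAcyclic ∧ e ∈ F) *
      #(E.powerset.filter fun F : Finset (Sym2 V) =>
        (fromEdgeSet ((F : Finset (Sym2 V)) : Set (Sym2 V))).IsAcyclic ∧ f ∈ F) :=
  forests_negCorr_of_rayleigh E (forestsW_rayleigh_of_card_le_five hV E hE) E subset_rfl he hf hef

/-- **Connection events of the weighted random forest are positively correlated on graphs with at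
most five vertices** (Theorem A of the memo, all activities): for loop-free `T` on `≤ 5` vertices,
disjoint `D, K ⊆ T` and vertices `a, b, c, d` with `ab, cd ∈ T` (or equal),
`Z[a↔b]·Z[c↔d] ≤ Z·Z[a↔b, c↔d]` in the pinned ensemble `(D;K)`. -/
theorem forestsW_conn_posCorr_of_card_le_five (hV : Fintype.card V ≤ 5) (T : Finset (Sym2 V))
    (hT : ∀ z ∈ T, ¬z.IsDiag) (w : Sym2 V → ℝ) (hw : ∀ x, 0 ≤ w x) (D K : Finset (Sym2 V))
    (hDK : Disjoint D K) (hsub : D ∪ K ⊆ T) {a b c d : V} (hab : a = b ∨ s(a, b) ∈ T)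
    (hcd : c = d ∨ s(c, d) ∈ T) :
    (∑ G ∈ D.powerset.filter (fun G =>
        (fromEdgeSet ((G ∪ K : Finset (Sym2 V)) : Set (Sym2 V))).IsAcyclic ∧
        (fromEdgeSet ((G ∪ K : Finset (Sym2 V)) : Set (Sym2 V))).Reachable a b), ∏ x ∈ G, w x) *
      (∑ G ∈ D.powerset.filter (fun G =>
        (fromEdgeSet ((G ∪ K : Finset (Sym2 V)) : Set (Sym2 V))).IsAcyclic ∧
        (fromEdgeSet ((G ∪ K : Finset (Sym2 V)) : Set (Sym2 V))).Reachable c d), ∏ x ∈ G, w x) ≤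
    (∑ G ∈ D.powerset.filter (fun G =>
        (fromEdgeSet ((G ∪ K : Finset (Sym2 V)) : Set (Sym2 V))).IsAcyclic), ∏ x ∈ G, w x) *
      (∑ G ∈ D.powerset.filter (fun G =>
        (fromEdgeSet ((G ∪ K : Finset (Sym2 V)) : Set (Sym2 V))).IsAcyclic ∧
        ((fromEdgeSet ((G ∪ K : Finset (Sym2 V)) : Set (Sym2 V))).Reachable a b ∧
         (fromEdgeSet ((G ∪ K : Finset (Sym2 V)) : Set (Sym2 V))).Reachable c d)), ∏ x ∈ G, w x) :=
  forestsW_conn_posCorr_of_rayleigh T hT (forestsW_rayleigh_of_card_le_five hV T hT) w hw D K hDK hsub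
    hab hcd

end Summit.CriticalPhenomena.PercolationContinuityZ3.Theorems.ForestRayleigh
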